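/-
Copyright (c) 2026 the pub-hodgecm-mathlib formalisation cell (harness21).  Prover seat hodgecm-mathlib-LH7-p04 (g12), 2026-09-03.
Road M6 → F3 «TOT-Λ BY OVER-ORDERS» (LEAD F0P3a-plan (g16) T14-66; sigsheet SIG-F3-5 v1 6925585c, F3-5 pen by (α)-lineage), brick F3-5b-II «THE CLOSED FORMS».
-/
import Literature.NumberTheory.Automorphic.OverOrderStrataTotal               -- ★ F3-5a (this seat) p853095: `ncard_setOf_selfDual_stable_eq_lawSum`
import Literature.NumberTheory.Automorphic.OverOrderStrataVerdicts             -- ★ F3-5b-I (this seat): `herm_and_level_of_stratum_nonempty`, `exists_subring_ncard_stratum_eq_of_gate`, `stratum_eq_empty_of_gate`, `algebraMap_mem_map_of_coe_eq_glued`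
import Literature.NumberTheory.Automorphic.GluedOverOrderBoundaryIndex         -- ★ (c10) (F0P3a-p02 (g27)) p853052: `setOf_glued_zero_eq`, `relIndex_units_comap_norm_prodOrder_eq_pow`
import Literature.NumberTheory.Automorphic.SelfDualProductOrderGate            -- ★ (c10b-N) (F0P3a-p02 (g27)) p853089: `not_exists_selfDual_cyclicOver_of_forall_valuation_ne_one`
import Literature.NumberTheory.Automorphic.HermitianCharacterClassesDescent    -- ★ (c12) (LH10-p01 (g10)) p853068: `natCard_hermitianLevelClasses_eq_natCard_levelChars`
import Literature.NumberTheory.Automorphic.GluedOverOrdersCountLaw             -- ★ (S7b) (LH7-p04 (g11)) p853033: `natCard_levelChars_zero ∕ _odd ∕ _even`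
import Literature.NumberTheory.Automorphic.QuadraticOrderInvolutionStable      -- ★ (c7) (LH10-p01 (g10)) p853058: `forall_sigma_smul_le_of_smul_le` (FILE 2's `hordσ`)
import Literature.NumberTheory.Rogawski1990.OverOrderLawClosedForms            -- ★ F3-4 (F0P3a-p04 (g30)) p853015: `overOrderLawSum_classOne_eq_phiTHn ∕ _classTwo_eq_phiTHprimen`
import HarnessLib

/-!
# The self-dual `τ`-stable lattices of a type-(2) unitary counted in closed form: `#{Λ} = Φ(t) ∕ Φ′(t″)` (`phiTHn ∕ phiTHprimen`), SPAN currency, endoscopic frame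

Topic `NumberTheory/Automorphic`; namespace `Literature.NumberTheory.Automorphic`.  THEOREMS ONLY (no definition, no instance, no notation, no named fact, no `sorry`).
Cell `pub/hodgecm-mathlib` (D-0151), crux H413 = `stmt-HodgeConjecture-24833`; road M6 → F3 «TOT-Λ by over-orders», brick **F3-5b-II** = sigsheet SIG-F3-5 v1 (6925585c) step (S8):
★ F3-5a's strata total + ★ F3-5b-I's per-stratum verdicts (`b ≥ 1`) + the boundary `b = 0` (★ (c10) index `q^{N″}`, ★ (c10b-N) emptiness in class II, the class-I witness as the binder
`hgate₀` = carve (c10b-S)) + ★ (c12) hermitian classes = `𝒪_F`-classes + ★ (S7b) the level function's values + ★ F3-4 the closed forms.  Frame = ★ F3-5b-I's VERBATIM (★ FILE 2's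
endoscopic letters read integrally, ★ F3-3's inert-dictionary Eisenstein letters at `O₁ := 𝒪_K`) plus `σ_K ∘ algebraMap = algebraMap ∘ σ` (`hσKE`, which with ★ (c7) DISCHARGES FILE 2's
`hordσ`), the type-(2) order `(x_R, hxR, c_F, hR)` (★ (c6)'s head shape, `c_R := ιO c_F`), the order `m` of `c_F` (`hm`) on a LAWFUL row (`hlaw`), and the PARITY data: the CLASS of
the `E`-line `x₀ = φ(1,0)·w₀` (class I ⟺ `∃ c ≠ 0, |σ(c)c⟨x₀,x₀⟩| = 1`, ★ (c10b-N)'s token), the gate `hgate` at deep unitary generators (★ F3-5b-I's binder, `b ≥ 1`; F3-5b-III: ★ (c8)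
+ the F4 gates + the model package (c5-ii)) and the class-I witness `hgate₀` at the product orders (`b = 0`; carve (c10b-S)).
HONEST LABEL: HC_CM is proved only modulo the 2 remaining named inputs (hLiu418 24832, h413 24833) until rung 0 closes; assembly of ★ bricks, asserts nothing printed; count-neutral
(pays no organ; zero label movement until F5 ★ and a desk-priced rider).

* §1 `hordσ_of_integral_frame` (FILE 2's `hordσ` from ★ (c7)), `one_zero_mem_glued_zero`, `fst_mem_integer_of_mem_map` (the two side conditions of ★ (c10b-N) at `incl S`).
* §2 **`ncard_setOf_selfDual_stable_eq_lawSum_levelChars`** — the count as ★ F3-4's double sum with ★ (S7b)'s level function, for a class index `cls` (`cls = 0` ⟺ class I).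
* §3 **`ncard_setOf_selfDual_stable_eq_phiTHn`** (class I), **`ncard_setOf_selfDual_stable_eq_phiTHprimen`** (class II).

## References
* [Rogawski1990] J. D. Rogawski, *Automorphic Representations of Unitary Groups in Three Variables*, Ann. of Math. Stud. 123 (1990): §4.9 Lemma 4.9.3 p. 56, Prop. 4.9.1 (b) p. 55.
* [Flicker1998UnitaryFL] Y. Z. Flicker, *Elementary proof of the fundamental lemma for a unitary group*, Canad. J. Math. 50 (1998): Props. 7, 11, 16–17, Theorem 18 p. 97.
* [Jacobowitz1962] R. Jacobowitz, *Hermitian forms over local fields*, Amer. J. Math. 84 (1962): §4, §7.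
* [Neukirch1999] J. Neukirch, *Algebraic Number Theory*, Grundlehren 322 (1999): Ch. I §12.
-/

set_option autoImplicit false

noncomputable section

open Matrix Polynomial Finset
open scoped MatrixGroups ValuativeRel Pointwise

namespace Literature.NumberTheory.Automorphic

open Literature.NumberTheory.Automorphic.UnitaryGroup ValuativeRel Literature.NumberTheory.Rogawski1990.Flicker1998

variable {F E : Type*} [Field F] [ValuativeRel F] [Field E] [ValuativeRel E] (σ : E →+* E)
  {K : Type*} [Field K] [ValuativeRel K] [Algebra E K] (σK : K →+* K)
  -- ★ F3-2b ∕ F3-2a's endoscopic frame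
  (hσσ : ∀ x, σ (σ x) = x) (hσK : ∀ x, σK (σK x) = x) (hσO : ∀ x : 𝒪[E], σ x ∈ 𝒪[E]) (hK2 : Module.finrank E K = 2)
  (J : GL (Fin 3) E) (hJ : J ∈ glInt 3 E) (hJh : ((J : Matrix (Fin 3) (Fin 3) E).map σ)ᵀ = J)
  (τ : Matrix (Fin 3) (Fin 3) E) {w₀ : Fin 3 → E} (hK : IsUnit (Matrix.of fun i j : Fin 3 => ((τ ^ (j : ℕ)) *ᵥ w₀) i).det)
  (φ : (E × K) →ₐ[E] Matrix (Fin 3) (Fin 3) E) (hφ : Function.Injective φ) (τB : E × K) (hτB : φ τB = τ)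
  (hstar : ∀ b : E × K, (J : Matrix (Fin 3) (Fin 3) E) * φ (RingHom.prodMap σ σK b) = ((φ b).map σ)ᵀ * J)
  -- ★ (c4)'s integral reading, and `σ_K` over `σ`
  (hOK : ∀ r : 𝒪[E], algebraMap E K (r : E) ∈ 𝒪[K]) (hσKE : ∀ x : E, σK (algebraMap E K x) = algebraMap E K (σ x))
  (jO : 𝒪[E] →+* 𝒪[K]) (hjO : ∀ x : 𝒪[E], ((jO x : 𝒪[K]) : K) = algebraMap E K x)
  (σO : 𝒪[E] →+* 𝒪[E]) (hσO' : ∀ x : 𝒪[E], ((σO x : 𝒪[E]) : E) = σ x)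
  (σKO : 𝒪[K] →+* 𝒪[K]) (hσKO : ∀ z : 𝒪[K], ((σKO z : 𝒪[K]) : K) = σK z)
  (hσv : ∀ x, valuation E (σ x) = valuation E x) (hσKv : ∀ z, valuation K (σK z) = valuation K z)
  -- ★ F3-3 ∕ F3-1a's Eisenstein letters over the inert dictionary, at `O₁ := 𝒪[K]`
  (ιO : 𝒪[F] →+* 𝒪[E]) (θ : 𝒪[K]) {aF k₀F : 𝒪[F]}
  (hσι : ∀ y, σO (ιO y) = ιO y) (hfixO : ∀ x, σO x = x → ∃ y, ιO y = x) (hιinj : Function.Injective ιO) (hιu : ∀ y, IsUnit (ιO y) → IsUnit y)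
  (htr : ∃ b₀ : 𝒪[E], b₀ + σO b₀ = 1)
  (hσ₁j : ∀ x, σKO (jO x) = jO (σO x)) (hσ₁θ : σKO θ = θ)
  (hθ : θ ^ 2 = jO (ιO aF) * θ + jO (ιO k₀F)) (haF : aF ∈ IsLocalRing.maximalIdeal 𝒪[F]) (hk₀ : k₀F ∈ IsLocalRing.maximalIdeal 𝒪[F])
  (hcoord : ∀ z : 𝒪[K], ∃! bc : 𝒪[E] × 𝒪[E], z = jO bc.1 + jO bc.2 * θ)
  (hnormE : ∀ b : 𝒪[E], IsUnit b → σO b = b → ∃ c : 𝒪[E], c * σO c = b) (hnorm₁ : ∀ z : 𝒪[K], IsUnit z → σKO z = z → ∃ w : 𝒪[K], w * σKO w = z)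
  {ϖF : F} {ϖ : E} (hϖF : IsUniformizingElement ϖF) (hϖ : IsUniformizingElement ϖ) (hιϖ : ιO ⟨ϖF, hϖF.mem⟩ = ⟨ϖ, hϖ.mem⟩)
  (hk₁ : valuation E ((ιO k₀F : 𝒪[E]) : E) = valuation E ϖ) (hq : Nat.card 𝓀[E] = Nat.card 𝓀[F] ^ 2)
  {ξ : 𝒪[E]} (hξ : IsUnit (ξ - σO ξ))
  (hnormEb : ∀ b : ℕ, 1 ≤ b → ∀ r : 𝒪[E], σO r = r → r - 1 ∈ Ideal.span ({(⟨ϖ, hϖ.mem⟩ : 𝒪[E]) ^ b} : Set 𝒪[E]) →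
    ∃ w : 𝒪[E], w - 1 ∈ Ideal.span ({(⟨ϖ, hϖ.mem⟩ : 𝒪[E]) ^ b} : Set 𝒪[E]) ∧ w * σO w = r)
  -- the type-(2) order `𝒪_E[x_R] = G(N, n, ιO c_F)` over `τ_B = incl x_R` (★ (c6) `exists_coe_range_eval₂_eq_glued_map(_of_deep)`)
  (xR : 𝒪[E] × 𝒪[K]) (hxR : RingHom.prodMap (𝒪[E]).subtype (𝒪[K]).subtype xR = τB) {N n : ℕ} (cF : 𝒪[F])
  (hR : ((Polynomial.eval₂RingHom (RingHom.prod (RingHom.id 𝒪[E]) jO) xR).range : Set (𝒪[E] × 𝒪[K])) =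
    {z : 𝒪[E] × 𝒪[K] | ∃ b₀ c₀ : 𝒪[E], z.2 = jO b₀ + jO c₀ * (jO ((⟨ϖ, hϖ.mem⟩ : 𝒪[E]) ^ N) * θ) ∧
      z.1 - (b₀ + c₀ * ιO cF) ∈ Ideal.span {(⟨ϖ, hϖ.mem⟩ : 𝒪[E]) ^ n}})
  (cls : ℕ)
  -- the PARITY GATE at a deep unitary generator (★ F3-5b-I's binder VERBATIM)
  (hgate : ∀ (N'' b : ℕ) (u' p' q' t' D' : 𝒪[E]), 1 ≤ b →
    ((u', jO p' + jO q' * θ) : 𝒪[E] × 𝒪[K]) * RingHom.prodMap σO σKO (u', jO p' + jO q' * θ) = 1 →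
    u' - 1 ∈ IsLocalRing.maximalIdeal 𝒪[E] → p' - 1 ∈ IsLocalRing.maximalIdeal 𝒪[E] → 1 - t' + D' ∈ IsLocalRing.maximalIdeal 𝒪[E] →
    (jO p' + jO q' * θ) ^ 2 - jO t' * (jO p' + jO q' * θ) + jO D' = 0 →
    valuation E ((q' : 𝒪[E]) : E) = valuation E ϖ ^ N'' →
    valuation E ((u' * u' - t' * u' + D' : 𝒪[E]) : E) = valuation E ϖ ^ b →
    ((∃ w : Fin 3 → E, ∃ g ∈ unitaryGroupOfForm σ (J : Matrix (Fin 3) (Fin 3) E),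
        Submodule.span 𝒪[E] ((fun x : E × K => φ x *ᵥ w) ''
          (((Polynomial.eval₂RingHom (RingHom.prod (RingHom.id 𝒪[E]) jO) ((u', jO p' + jO q' * θ) : 𝒪[E] × 𝒪[K])).range.map
            (RingHom.prodMap (𝒪[E]).subtype (𝒪[K]).subtype) : Subring (E × K)) : Set (E × K))) =
        Submodule.span 𝒪[E] (Set.range ((g : Matrix (Fin 3) (Fin 3) E))ᵀ)) ↔ b % 2 = cls))
  -- the class-I WITNESS at the product orders `𝒪_E × O_{N″}` (★ (c10b-S3-A) `exists_selfDual_cyclicOver_map_of_even_log`'s shape: ★ (c10) §0's product-set literal ⇒ ★ F3-2a's `hb₀`)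
  (hgate₀ : cls = 0 → ∀ (N'' : ℕ) (S : Subring (𝒪[E] × 𝒪[K])), (S : Set (𝒪[E] × 𝒪[K])) =
      {z : 𝒪[E] × 𝒪[K] | ∃ b₀ c₀ : 𝒪[E], z.2 = jO b₀ + jO c₀ * (jO ((⟨ϖ, hϖ.mem⟩ : 𝒪[E]) ^ N'') * θ)} →
    ∃ b₀ : (E × K)ˣ, ∃ g ∈ unitaryGroupOfForm σ (J : Matrix (Fin 3) (Fin 3) E),
      Submodule.span 𝒪[E] ((fun x : E × K => φ x *ᵥ (φ (b₀ : E × K) *ᵥ w₀)) ''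
        ((S.map (RingHom.prodMap (𝒪[E]).subtype (𝒪[K]).subtype) : Subring (E × K)) : Set (E × K))) =
      Submodule.span 𝒪[E] (Set.range ((g : Matrix (Fin 3) (Fin 3) E))ᵀ))

/-! ## §1 Frame lemmas: FILE 2's `hordσ` from ★ (c7); the product orders contain `e₁ = (1, 0)`; first coordinates of `incl S` are integral -/

include hOK hσKE hjO hσKO hσv hσ₁θ hcoord in
/-- **FILE 2's binder `hordσ` DISCHARGED** (★ (c7) `forall_sigma_smul_le_of_smul_le`): the orders of `K ⊇ 𝒪_E` are `σ_K`-stable — from the integral basis `(1, θ)` of `𝒪_K` with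
`σ_K θ = θ`, `σ_K` over `σ` (`hσKE`) and `|σ x| = |x|`. [cite: Neukirch1999, Ch. I §12] [cite: Jacobowitz1962, §7] -/
theorem hordσ_of_integral_frame :
    ∀ L : Submodule 𝒪[E] K, L.FG → ∀ c : K, c • L ≤ L → σK c • L ≤ L := by
  refine forall_sigma_smul_le_of_smul_le hOK σ σK hσKE hσv (θ : K) (by rw [← hσKO, hσ₁θ]) fun z hz => ?_
  obtain ⟨⟨b, c⟩, hz', -⟩ := hcoord ⟨z, hz⟩
  refine ⟨b, c, b.2, c.2, ?_⟩
  have h := congrArg Subtype.val hz'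
  simpa only [Subring.coe_add, Subring.coe_mul, hjO] using h

omit [Algebra E K] in
/-- `e₁ = (1, 0)` lies in every product order `G(N″, 0, c′)` (`b₀ = 1`, `c₀ = 0`, glue modulo `π^0 = 1`). [cite: Neukirch1999, Ch. I §12] -/
theorem one_zero_mem_glued_zero (N'' : ℕ) (c' : 𝒪[E]) :
    (((1, 0) : 𝒪[E] × 𝒪[K])) ∈ {z : 𝒪[E] × 𝒪[K] | ∃ b₀ c₀ : 𝒪[E], z.2 = jO b₀ + jO c₀ * (jO ((⟨ϖ, hϖ.mem⟩ : 𝒪[E]) ^ N'') * θ) ∧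
      z.1 - (b₀ + c₀ * c') ∈ Ideal.span {(⟨ϖ, hϖ.mem⟩ : 𝒪[E]) ^ 0}} :=
  ⟨0, 0, by simp, by rw [pow_zero, Ideal.span_singleton_one]; exact Submodule.mem_top⟩

omit [Algebra E K] in
/-- First coordinates of `incl S` are integral. [cite: Neukirch1999, Ch. I §12] -/
theorem fst_mem_integer_of_mem_map (S : Subring (𝒪[E] × 𝒪[K])) (x : E × K)
    (hx : x ∈ S.map (RingHom.prodMap (𝒪[E]).subtype (𝒪[K]).subtype)) : x.1 ∈ 𝒪[E] := by
  obtain ⟨z, -, rfl⟩ := Subring.mem_map.1 hx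
  exact z.1.2

/-! ## §2 The count as ★ F3-4's double sum with ★ (S7b)'s level function -/

include hσσ hσK hσO hK2 hJ hJh hK hφ hτB hstar hOK hσKE hjO hσO' hσKO hσv hσKv hσι hfixO hιinj hιu htr hσ₁j hσ₁θ hθ haF hk₀ hcoord hnormE hnorm₁ hιϖ hk₁ hq hξ hnormEb
  hxR hR hgate hgate₀ in
/-- **THE SELF-DUAL `τ`-STABLE LATTICES COUNTED BY THE OVER-ORDER LAW**, for a class index `cls` (`cls = 0` ⟺ the `E`-line `x₀ = φ(1,0)·w₀` is of CLASS I,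
`∃ c ≠ 0, |σ(c)c⟨x₀,x₀⟩| = 1`): ★ F3-5a with `hzero` ≔ ★ F3-5b-I §1; `hgood`∕`hbad` ≔ ★ F3-5b-I §2 at `b ≥ 1` (through `hgate`) and, at `b = 0`, the product order `G(N″,0,c′)`
(★ F3-1a `exists_subring_coe_eq_glued`) counted by ★ F3-2a + ★ (c4) §3 + ★ (c10) `= q^{N″}` from the class-I witness `hgate₀`, resp. EMPTY in class II by ★ (c10b-N); then the
hermitian level classes are ★ (S7b)'s `levelChars` of `𝒪_F` (★ (c12)).  [cite: Rogawski1990, §4.9 Lemma 4.9.3 p. 56, Prop. 4.9.1 (b) p. 55] [cite: Jacobowitz1962, §7]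
[cite: Flicker1998UnitaryFL, Props. 7, 11, 16–17] -/
theorem ncard_setOf_selfDual_stable_eq_lawSum_levelChars [Finite 𝓀[F]] [Finite 𝓀[E]] [IsDiscreteValuationRing 𝒪[E]]
    (hclsI : (∃ c : E, c ≠ 0 ∧ valuation E (σ c * c *
      dotProduct (fun i => σ ((φ ((1, 0) : E × K) *ᵥ w₀) i)) ((J : Matrix (Fin 3) (Fin 3) E) *ᵥ (φ ((1, 0) : E × K) *ᵥ w₀))) = 1) ↔ cls = 0) :
    {Λ : Submodule 𝒪[E] (Fin 3 → E) |
        (∃ u ∈ unitaryGroupOfForm σ (J : Matrix (Fin 3) (Fin 3) E), Λ = Submodule.span 𝒪[E] (Set.range ((u : Matrix (Fin 3) (Fin 3) E))ᵀ)) ∧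
          Λ.map ((Matrix.toLin' τ).restrictScalars 𝒪[E]) ≤ Λ}.ncard =
      ∑ b ∈ (Finset.range (n + 1)).filter (fun b => b % 2 = cls), ∑ N'' ∈ Finset.range (N + 1),
        (if b = 0 then Nat.card 𝓀[F] ^ N'' else (Nat.card 𝓀[F] + 1) * Nat.card 𝓀[F] ^ (N'' + b - 1)) *
          Nat.card {w : 𝒪[F] ⧸ Ideal.span ({(⟨ϖF, hϖF.mem⟩ : 𝒪[F]) ^ b} : Set 𝒪[F]) //
            ∃ y : 𝒪[F], Ideal.Quotient.mk _ y = w ∧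
              ((b = 0 ∨ (b = 2 * N'' + 1 ∧ y ∈ Ideal.span ({(⟨ϖF, hϖF.mem⟩ : 𝒪[F]) ^ (N'' + 1)} : Set 𝒪[F])) ∨
                  ∃ M : ℕ, 1 ≤ M ∧ M ≤ N'' ∧ b = 2 * M ∧ y ∈ Ideal.span ({(⟨ϖF, hϖF.mem⟩ : 𝒪[F]) ^ M} : Set 𝒪[F]) ∧
                    y ∉ Ideal.span ({(⟨ϖF, hϖF.mem⟩ : 𝒪[F]) ^ (M + 1)} : Set 𝒪[F])) ∧
                (⟨ϖF, hϖF.mem⟩ : 𝒪[F]) ^ (N - N'') * y - cF ∈ Ideal.span ({(⟨ϖF, hϖF.mem⟩ : 𝒪[F]) ^ b} : Set 𝒪[F]))} := by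
  set π : 𝒪[E] := ⟨ϖ, hϖ.mem⟩ with hπdef
  have hσσO : ∀ x, σO (σO x) = x := fun x => Subtype.ext (by rw [hσO', hσO', hσσ])
  have hθ' : θ * θ = jO (ιO aF) * θ + jO (ιO k₀F) := by rw [← sq]; exact hθ
  have hq0 : 0 < Nat.card 𝓀[F] := Nat.card_pos
  set incl : 𝒪[E] × 𝒪[K] →+* E × K := RingHom.prodMap (𝒪[E]).subtype (𝒪[K]).subtype with hincl
  -- F3-2a's frame hypotheses in `E`-currency
  have htrE : ∃ b₀ : 𝒪[E], (b₀ : E) + σ b₀ = 1 := by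
    obtain ⟨b₀, hb₀⟩ := htr
    exact ⟨b₀, by rw [← hσO', ← Subring.coe_add, hb₀]; rfl⟩
  have hnorm : ∀ v : 𝒪[E], IsUnit v → σ v = v → ∃ t : 𝒪[E], (t : E) * σ t = v := by
    intro v hv hσv'
    obtain ⟨c, hc⟩ := hnormE v hv (Subtype.ext (by rw [hσO']; exact hσv'))
    exact ⟨c, by rw [← hσO', ← Subring.coe_mul, hc]⟩
  -- ★ F3-5a with the three verdicts
  rw [ncard_setOf_selfDual_stable_eq_lawSum σ σK hσσ hσK hσO hK2 J hJ τ hK φ hφ τB hτB hstar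
    (hordσ_of_integral_frame σ σK hOK hσKE jO hjO σKO hσKO hσv θ hσ₁θ hcoord) hOK jO hjO θ hθ' hcoord hϖ σO xR hxR (ιO cF) hq0 cls hR ?_ ?_ ?_]
  · -- ★ (c12): hermitian level classes of `𝒪_E` = ★ (S7b)'s level classes of `𝒪_F`
    refine Finset.sum_congr rfl fun b _ => Finset.sum_congr rfl fun N'' _ => ?_
    rw [natCard_hermitianLevelClasses_eq_natCard_levelChars ιO σO hσσO hσι hfixO hιinj htr hϖF hϖ hιϖ N N'' b cF]
  · -- `hzero` (★ F3-5b-I §1)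
    intro N'' _ b _ c' hlaw _ S hS hne
    exact herm_and_level_of_stratum_nonempty σ σK hσσ hσO hK2 J hJ τ hK φ hφ τB hτB hstar jO hjO σO hσO' σKO hσKO ιO θ hσι hιu hσ₁j hσ₁θ hθ haF
      hcoord hϖF hϖ hιϖ hk₁ hlaw S hS hne
  · -- `hgood`
    intro N'' hN'' b hb c' hherm hlvl hcomp hbcls
    rcases Nat.eq_zero_or_pos b with hb0 | hb1
    · -- `b = 0`: the product order, counted by the class-I witness, ★ F3-2a, ★ (c4) §3, ★ (c10)
      subst hb0
      have hcls0 : cls = 0 := by omega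
      obtain ⟨S, hS⟩ := exists_subring_coe_eq_glued jO θ π hθ' N'' 0 c' (by rw [pow_zero, Ideal.span_singleton_one]; exact Submodule.mem_top)
      refine ⟨S, hS, ?_⟩
      have hO : ∀ r : 𝒪[E], algebraMap E (E × K) (r : E) ∈ S.map incl := algebraMap_mem_map_of_coe_eq_glued jO hjO θ hϖ S hS
      obtain ⟨b₀, hb₀⟩ := hgate₀ hcls0 N'' S (by rw [hS]; exact setOf_glued_zero_eq jO θ π N'' c')
      rw [if_pos rfl, ncard_setOf_selfDual_cyclicOver_eq_relIndex σ hσσ hσO htrE hnorm J hJ hJh τ hK φ hφ τB hτB (RingHom.prodMap σ σK) hstar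
          (S.map incl) hO b₀ hb₀, hincl, relIndex_units_map_prodMap_eq σO σ hσO' σKO σK hσKO hσv hσKv S]
      refine relIndex_units_comap_norm_prodOrder_eq_pow ιO σO jO σKO θ hσσO hσι hfixO hιinj hιu hσ₁j hσ₁θ hθ haF hk₀ hcoord hnormE hnorm₁
        hϖF hϖ hιϖ hq N'' S ?_
      rw [hS]; exact setOf_glued_zero_eq jO θ π N'' c'
    · -- `b ≥ 1`: ★ F3-5b-I §2
      rw [if_neg (by omega)]
      exact exists_subring_ncard_stratum_eq_of_gate σ σK hσσ hσO J hJ hJh τ hK φ hφ τB hτB hstar jO hjO σO hσO' σKO hσKO hσv hσKv ιO θ hσι hfixO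
        hιinj hιu htr hσ₁j hσ₁θ hθ haF hk₀ hcoord hnormE hnorm₁ hϖF hϖ hιϖ hk₁ hq hξ hnormEb cls hgate hb1 hherm (hlvl.resolve_left (by omega)) hbcls
  · -- `hbad`
    intro N'' hN'' b hb c' hherm hlvl hcomp hbcls S hS
    rcases Nat.eq_zero_or_pos b with hb0 | hb1
    · -- `b = 0`: class II, ★ (c10b-N) + ★ F3-2a
      subst hb0
      have hcls1 : ¬ cls = 0 := fun h => hbcls (by rw [h])
      have hII : ∀ c : E, c ≠ 0 → valuation E (σ c * c *
          dotProduct (fun i => σ ((φ ((1, 0) : E × K) *ᵥ w₀) i)) ((J : Matrix (Fin 3) (Fin 3) E) *ᵥ (φ ((1, 0) : E × K) *ᵥ w₀))) ≠ 1 :=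
        fun c hc h1 => hcls1 (hclsI.1 ⟨c, hc, h1⟩)
      have hO : ∀ r : 𝒪[E], algebraMap E (E × K) (r : E) ∈ S.map incl := algebraMap_mem_map_of_coe_eq_glued jO hjO θ hϖ S hS
      have he₁ : ((1, 0) : E × K) ∈ S.map incl := by
        refine Subring.mem_map.2 ⟨((1, 0) : 𝒪[E] × 𝒪[K]), ?_, Prod.ext rfl rfl⟩
        rw [← SetLike.mem_coe, hS]; exact one_zero_mem_glued_zero jO θ hϖ N'' c'
      exact setOf_selfDual_cyclicOver_eq_empty σ J τ hK φ hφ τB hτB (S.map incl) hO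
        (not_exists_selfDual_cyclicOver_of_forall_valuation_ne_one σ σK hσO J hJ τ hK φ hφ τB hτB hstar (S.map incl) hO he₁
          (fst_mem_integer_of_mem_map S) hϖ.ne_zero hϖ.valuation_lt_one hII)
    · exact stratum_eq_empty_of_gate σ hσσ J τ hK φ hφ τB hτB jO hjO σO hσO' σKO ιO θ hσι hfixO hιinj hιu htr hσ₁j hσ₁θ hθ haF hk₀ hcoord hϖF hϖ
        hιϖ hk₁ hξ hnormEb cls hgate hb1 hherm (hlvl.resolve_left (by omega)) hbcls S hS

/-! ## §3 The closed forms (★ F3-4) -/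

include hσσ hσK hσO hK2 hJ hJh hK hφ hτB hstar hOK hσKE hjO hσO' hσKO hσv hσKv hσι hfixO hιinj hιu htr hσ₁j hσ₁θ hθ haF hk₀ hcoord hnormE hnorm₁ hιϖ hk₁ hq hξ hnormEb
  hxR hR hgate hgate₀ in
/-- **CLASS I: `#{Λ | self-dual, τ-stable} = Φ(t) = phiTHn q n N`** on a lawful row (`n = 2m`, `1 ≤ m ≤ N`, or the deep row `n = 2N+1`, `N+1 ≤ m`; `m = ord c_F`) or the BOUNDARY row `n = 0` (product order; `Σ_{N″≤N} q^{N″}`), when the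
`E`-line `x₀` is of class I and the gate reads `b ≡ 0`.  (§2 at `cls = 0`, then ★ (S7b) `natCard_levelChars_zero ∕ _even` and ★ F3-4 (I).)
[cite: Rogawski1990, §4.9 Lemma 4.9.3 p. 56, Prop. 4.9.1 (b) p. 55] [cite: Flicker1998UnitaryFL, Prop. 11 p. 87; Theorem 18 p. 97] -/
theorem ncard_setOf_selfDual_stable_eq_phiTHn [Finite 𝓀[F]] [Finite 𝓀[E]] [IsDiscreteValuationRing 𝒪[E]] [IsDiscreteValuationRing 𝒪[F]]
    (hcls : cls = 0)
    (hI : ∃ c : E, c ≠ 0 ∧ valuation E (σ c * c *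
      dotProduct (fun i => σ ((φ ((1, 0) : E × K) *ᵥ w₀) i)) ((J : Matrix (Fin 3) (Fin 3) E) *ᵥ (φ ((1, 0) : E × K) *ᵥ w₀))) = 1)
    {m : ℕ} (hlaw : n = 0 ∨ (n = 2 * m ∧ 1 ≤ m ∧ m ≤ N) ∨ (n = 2 * N + 1 ∧ N + 1 ≤ m))
    (hm : ∀ j : ℕ, cF ∈ Ideal.span ({(⟨ϖF, hϖF.mem⟩ : 𝒪[F]) ^ j} : Set 𝒪[F]) ↔ j ≤ m) :
    (({Λ : Submodule 𝒪[E] (Fin 3 → E) |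
        (∃ u ∈ unitaryGroupOfForm σ (J : Matrix (Fin 3) (Fin 3) E), Λ = Submodule.span 𝒪[E] (Set.range ((u : Matrix (Fin 3) (Fin 3) E))ᵀ)) ∧
          Λ.map ((Matrix.toLin' τ).restrictScalars 𝒪[E]) ≤ Λ}.ncard : ℕ) : ℚ) = phiTHn (Nat.card 𝓀[F]) n N := by
  subst hcls
  have hq1 : 1 < Nat.card 𝓀[F] := Finite.one_lt_card
  rw [ncard_setOf_selfDual_stable_eq_lawSum_levelChars σ σK hσσ hσK hσO hK2 J hJ hJh τ hK φ hφ τB hτB hstar hOK hσKE jO hjO σO hσO' σKO hσKO hσv hσKv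
    ιO θ hσι hfixO hιinj hιu htr hσ₁j hσ₁θ hθ haF hk₀ hcoord hnormE hnorm₁ hϖF hϖ hιϖ hk₁ hq hξ hnormEb xR hxR cF hR 0 hgate hgate₀
    ⟨fun _ => rfl, fun _ => hI⟩]
  rcases hlaw with hn | hlaw
  · -- the boundary row `n = 0`: only `b = 0`, `Σ_{N″ ≤ N} q^{N″} = (q^{N+1} − 1)∕(q − 1) = phiTHM q 0 N`
    subst hn
    have hfilt : (Finset.range (0 + 1)).filter (fun b => b % 2 = 0) = {0} := by decide
    rw [hfilt, Finset.sum_singleton, Finset.sum_congr rfl fun N'' _ => by rw [if_pos rfl, natCard_levelChars_zero hϖF N N'' cF, mul_one],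
      Nat.cast_sum]
    simp only [Nat.cast_pow]
    have hq1' : (Nat.card 𝓀[F] : ℚ) ≠ 1 := by exact_mod_cast hq1.ne'
    rw [geom_sum_eq hq1' (N + 1), phiTHn, if_pos (Nat.zero_mod 2), Nat.zero_div, phiTHM, if_neg (Nat.not_lt_zero N), if_neg (by decide)]
    have h1 : (Nat.card 𝓀[F] : ℚ) - 1 ≠ 0 := sub_ne_zero.2 hq1'
    have h2 : (Nat.card 𝓀[F] : ℚ) ^ 2 + 1 ≠ 0 := by positivity
    field_simp
  · exact overOrderLawSum_classOne_eq_phiTHn hq1 hlaw _ (fun N'' _ => natCard_levelChars_zero hϖF N N'' cF)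
      (fun N'' _ M hM1 _ => natCard_levelChars_even hϖF hM1 cF hm)

include hσσ hσK hσO hK2 hJ hJh hK hφ hτB hstar hOK hσKE hjO hσO' hσKO hσv hσKv hσι hfixO hιinj hιu htr hσ₁j hσ₁θ hθ haF hk₀ hcoord hnormE hnorm₁ hιϖ hk₁ hq hξ hnormEb
  hxR hR hgate hgate₀ in
/-- **CLASS II: `#{Λ | self-dual, τ-stable} = Φ′(t″) = phiTHprimen q n N`** on a lawful row or the boundary row `n = 0` (value `0`), when the `E`-line `x₀` is of class II (`∀ c ≠ 0, |σ(c)c⟨x₀,x₀⟩| ≠ 1`) and the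
gate reads `b ≡ 1`.  (§2 at `cls = 1`, then ★ (S7b) `natCard_levelChars_odd` and ★ F3-4 (II).)
[cite: Rogawski1990, §4.9 Lemma 4.9.3 p. 56, Prop. 4.9.1 (b) p. 55] [cite: Flicker1998UnitaryFL, Props. 16–17 pp. 96–97; Theorem 18 p. 97] -/
theorem ncard_setOf_selfDual_stable_eq_phiTHprimen [Finite 𝓀[F]] [Finite 𝓀[E]] [IsDiscreteValuationRing 𝒪[E]] [IsDiscreteValuationRing 𝒪[F]]
    (hcls : cls = 1)
    (hII : ∀ c : E, c ≠ 0 → valuation E (σ c * c *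
      dotProduct (fun i => σ ((φ ((1, 0) : E × K) *ᵥ w₀) i)) ((J : Matrix (Fin 3) (Fin 3) E) *ᵥ (φ ((1, 0) : E × K) *ᵥ w₀))) ≠ 1)
    {m : ℕ} (hlaw : n = 0 ∨ (n = 2 * m ∧ 1 ≤ m ∧ m ≤ N) ∨ (n = 2 * N + 1 ∧ N + 1 ≤ m))
    (hm : ∀ j : ℕ, cF ∈ Ideal.span ({(⟨ϖF, hϖF.mem⟩ : 𝒪[F]) ^ j} : Set 𝒪[F]) ↔ j ≤ m) :
    (({Λ : Submodule 𝒪[E] (Fin 3 → E) |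
        (∃ u ∈ unitaryGroupOfForm σ (J : Matrix (Fin 3) (Fin 3) E), Λ = Submodule.span 𝒪[E] (Set.range ((u : Matrix (Fin 3) (Fin 3) E))ᵀ)) ∧
          Λ.map ((Matrix.toLin' τ).restrictScalars 𝒪[E]) ≤ Λ}.ncard : ℕ) : ℚ) = phiTHprimen (Nat.card 𝓀[F]) n N := by
  subst hcls
  rw [ncard_setOf_selfDual_stable_eq_lawSum_levelChars σ σK hσσ hσK hσO hK2 J hJ hJh τ hK φ hφ τB hτB hstar hOK hσKE jO hjO σO hσO' σKO hσKO hσv hσKv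
    ιO θ hσι hfixO hιinj hιu htr hσ₁j hσ₁θ hθ haF hk₀ hcoord hnormE hnorm₁ hϖF hϖ hιϖ hk₁ hq hξ hnormEb xR hxR cF hR 1 hgate hgate₀
    ⟨fun ⟨c, hc, h1⟩ => absurd h1 (hII c hc), fun h => absurd h one_ne_zero⟩]
  rcases hlaw with hn | hlaw
  · -- the boundary row `n = 0`: no odd level, `0 = phiTHprimeM q 0 N`
    subst hn
    have hfilt : (Finset.range (0 + 1)).filter (fun b => b % 2 = 1) = ∅ := by decide
    rw [hfilt, Finset.sum_empty, Nat.cast_zero, phiTHprimen, if_pos (Nat.zero_mod 2), Nat.zero_div, phiTHprimeM, if_neg (Nat.not_lt_zero N)]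
    simp
  · exact overOrderLawSum_classTwo_eq_phiTHprimen Finite.one_lt_card hlaw _ (fun N'' hN'' b _ hb => natCard_levelChars_odd hϖF hN'' hb cF hm)

end Literature.NumberTheory.Automorphic

end
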